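import Summits.CriticalPhenomena.PercolationContinuityZ3.Theorems.PercNearOneGluingNoHeavyLowerTailKnQuestion8AntitheticWedgePoset
import HarnessLib

/-!
# `NoHeavyLowerTail` (crux stmt-CriticalPhenomena-4575), antithetic vdBHK programme: SHEET-BUILT subsets of the wedge gluing `T(X;L) = X × Fin 4`
# ('quadruple sets' `S₀ ×ˢ {0} ∪ S₁ ×ˢ {1} ∪ S₂ ×ˢ {2} ∪ S₃ ×ˢ {3}`) — membership, Boolean operations, the involution, cardinality, and up-closedness

Support file (seat `prim-ineq-gen-7` gen 52; `--supports stmt-CriticalPhenomena-4575`).  No `sorry`, no definitions.  Memo: FINDING-HUNT-g52.md §2b/§6.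
These are the bookkeeping lemmas for explicit up-sets of `T(X;L)` given by their four sheets (used by `AntitheticWedgeConverse`, THEOREM C of g52: an explicit
violating pair of up-sets of `T(T(X;L);L_T)` built from a nested violation of (R)(X,L)).
* `mem_quad` — `(s,i) ∈ S₀ ×ˢ {0} ∪ … ∪ S₃ ×ˢ {3}` iff `s` lies in the `i`-th set (four cases).
* `quad_inter`, `quad_sdiff`, `quad_image` (image under `(x,i) ↦ (ι x, s i)` with the sheet swap `0↔3, 1↔2`), `card_quad` (`= #S₀ + #S₁ + #S₂ + #S₃`).
* `quad_upset` — the quadruple set is up-closed for the wedge-gluing relation of `AntitheticWedgePoset` (down-set `L`) as soon as its sheets are up-sets of `X`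
  satisfying the T-pattern (`S₀ ⊆ S₂`, `S₁ ⊆ S₃`, `S₂ ∩ L ⊆ S₃`, `S₀ ∖ L ⊆ S₁`, the two cross conditions) — `upset_iff` specialised to sheet-built sets.
-/

namespace Summit.CriticalPhenomena.PercolationContinuityZ3.Theorems

open Finset

namespace AntitheticWedgeQuad

variable {X : Type*} [DecidableEq X]

/-- Membership in a sheet-built subset of `X × Fin 4`. -/
theorem mem_quad (S₀ S₁ S₂ S₃ : Finset X) (s : X) (i : Fin 4) :
    (s, i) ∈ S₀ ×ˢ ({0} : Finset (Fin 4)) ∪ S₁ ×ˢ ({1} : Finset (Fin 4)) ∪ S₂ ×ˢ ({2} : Finset (Fin 4)) ∪ S₃ ×ˢ ({3} : Finset (Fin 4)) ↔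
      (i = 0 ∧ s ∈ S₀) ∨ (i = 1 ∧ s ∈ S₁) ∨ (i = 2 ∧ s ∈ S₂) ∨ (i = 3 ∧ s ∈ S₃) := by
  simp only [Finset.mem_union, Finset.mem_product, Finset.mem_singleton]
  tauto

/-- Sheet-built sets: intersection is sheetwise. -/
theorem quad_inter (S₀ S₁ S₂ S₃ T₀ T₁ T₂ T₃ : Finset X) :
    (S₀ ×ˢ ({0} : Finset (Fin 4)) ∪ S₁ ×ˢ ({1} : Finset (Fin 4)) ∪ S₂ ×ˢ ({2} : Finset (Fin 4)) ∪ S₃ ×ˢ ({3} : Finset (Fin 4))) ∩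
      (T₀ ×ˢ ({0} : Finset (Fin 4)) ∪ T₁ ×ˢ ({1} : Finset (Fin 4)) ∪ T₂ ×ˢ ({2} : Finset (Fin 4)) ∪ T₃ ×ˢ ({3} : Finset (Fin 4))) =
      (S₀ ∩ T₀) ×ˢ ({0} : Finset (Fin 4)) ∪ (S₁ ∩ T₁) ×ˢ ({1} : Finset (Fin 4)) ∪ (S₂ ∩ T₂) ×ˢ ({2} : Finset (Fin 4)) ∪ (S₃ ∩ T₃) ×ˢ ({3} : Finset (Fin 4)) := by
  ext ⟨s, i⟩
  rw [Finset.mem_inter, mem_quad, mem_quad, mem_quad]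
  simp only [Finset.mem_inter]
  fin_cases i <;> simp

/-- Sheet-built sets: difference is sheetwise. -/
theorem quad_sdiff (S₀ S₁ S₂ S₃ T₀ T₁ T₂ T₃ : Finset X) :
    (S₀ ×ˢ ({0} : Finset (Fin 4)) ∪ S₁ ×ˢ ({1} : Finset (Fin 4)) ∪ S₂ ×ˢ ({2} : Finset (Fin 4)) ∪ S₃ ×ˢ ({3} : Finset (Fin 4))) \
      (T₀ ×ˢ ({0} : Finset (Fin 4)) ∪ T₁ ×ˢ ({1} : Finset (Fin 4)) ∪ T₂ ×ˢ ({2} : Finset (Fin 4)) ∪ T₃ ×ˢ ({3} : Finset (Fin 4))) =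
      (S₀ \ T₀) ×ˢ ({0} : Finset (Fin 4)) ∪ (S₁ \ T₁) ×ˢ ({1} : Finset (Fin 4)) ∪ (S₂ \ T₂) ×ˢ ({2} : Finset (Fin 4)) ∪ (S₃ \ T₃) ×ˢ ({3} : Finset (Fin 4)) := by
  ext ⟨s, i⟩
  rw [Finset.mem_sdiff, mem_quad, mem_quad, mem_quad]
  simp only [Finset.mem_sdiff]
  fin_cases i <;> simp

/-- Sheet-built sets under the involution `(x,i) ↦ (ι x, s i)` with the sheet swap `0↔3, 1↔2`: the sheets are permuted and mapped by `ι`. -/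
theorem quad_image (ι : X → X) (s : Fin 4 → Fin 4) (hs0 : s 0 = 3) (hs1 : s 1 = 2) (hs2 : s 2 = 1) (hs3 : s 3 = 0) (S₀ S₁ S₂ S₃ : Finset X) :
    (S₀ ×ˢ ({0} : Finset (Fin 4)) ∪ S₁ ×ˢ ({1} : Finset (Fin 4)) ∪ S₂ ×ˢ ({2} : Finset (Fin 4)) ∪ S₃ ×ˢ ({3} : Finset (Fin 4))).image
        (fun p => (ι p.1, s p.2)) =
      (S₃.image ι) ×ˢ ({0} : Finset (Fin 4)) ∪ (S₂.image ι) ×ˢ ({1} : Finset (Fin 4)) ∪ (S₁.image ι) ×ˢ ({2} : Finset (Fin 4)) ∪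
        (S₀.image ι) ×ˢ ({3} : Finset (Fin 4)) := by
  ext ⟨y, j⟩
  rw [Finset.mem_image, mem_quad]
  constructor
  · rintro ⟨⟨x, i⟩, hx, hxy⟩
    rw [mem_quad] at hx
    simp only [Prod.mk.injEq] at hxy
    obtain ⟨hy, hj⟩ := hxy
    subst hy; subst hj
    rcases hx with ⟨hi, hm⟩ | ⟨hi, hm⟩ | ⟨hi, hm⟩ | ⟨hi, hm⟩ <;> subst hi <;>
      simp [hs0, hs1, hs2, hs3, Finset.mem_image_of_mem ι hm]
  · intro h
    rcases h with ⟨hj, hm⟩ | ⟨hj, hm⟩ | ⟨hj, hm⟩ | ⟨hj, hm⟩ <;> subst hj <;> rw [Finset.mem_image] at hm <;> obtain ⟨x, hx, hxy⟩ := hm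
    · exact ⟨(x, 3), (mem_quad _ _ _ _ _ _).2 (Or.inr (Or.inr (Or.inr ⟨rfl, hx⟩))), by simp [hxy, hs3]⟩
    · exact ⟨(x, 2), (mem_quad _ _ _ _ _ _).2 (Or.inr (Or.inr (Or.inl ⟨rfl, hx⟩))), by simp [hxy, hs2]⟩
    · exact ⟨(x, 1), (mem_quad _ _ _ _ _ _).2 (Or.inr (Or.inl ⟨rfl, hx⟩)), by simp [hxy, hs1]⟩
    · exact ⟨(x, 0), (mem_quad _ _ _ _ _ _).2 (Or.inl ⟨rfl, hx⟩), by simp [hxy, hs0]⟩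

/-- Cardinality of a sheet-built set. -/
theorem card_quad (S₀ S₁ S₂ S₃ : Finset X) :
    (S₀ ×ˢ ({0} : Finset (Fin 4)) ∪ S₁ ×ˢ ({1} : Finset (Fin 4)) ∪ S₂ ×ˢ ({2} : Finset (Fin 4)) ∪ S₃ ×ˢ ({3} : Finset (Fin 4))).card =
      S₀.card + S₁.card + S₂.card + S₃.card := by
  have d01 : Disjoint (S₀ ×ˢ ({0} : Finset (Fin 4))) (S₁ ×ˢ ({1} : Finset (Fin 4))) := by
    rw [Finset.disjoint_left]; rintro ⟨x, i⟩ h0 h1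
    simp only [Finset.mem_product, Finset.mem_singleton] at h0 h1
    exact absurd (h0.2.symm.trans h1.2) (by decide)
  have d012 : Disjoint (S₀ ×ˢ ({0} : Finset (Fin 4)) ∪ S₁ ×ˢ ({1} : Finset (Fin 4))) (S₂ ×ˢ ({2} : Finset (Fin 4))) := by
    rw [Finset.disjoint_left]; rintro ⟨x, i⟩ h h2
    simp only [Finset.mem_union, Finset.mem_product, Finset.mem_singleton] at h h2
    rcases h with h | h
    · exact absurd (h.2.symm.trans h2.2) (by decide)
    · exact absurd (h.2.symm.trans h2.2) (by decide)
  have d0123 : Disjoint (S₀ ×ˢ ({0} : Finset (Fin 4)) ∪ S₁ ×ˢ ({1} : Finset (Fin 4)) ∪ S₂ ×ˢ ({2} : Finset (Fin 4))) (S₃ ×ˢ ({3} : Finset (Fin 4))) := by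
    rw [Finset.disjoint_left]; rintro ⟨x, i⟩ h h3
    simp only [Finset.mem_union, Finset.mem_product, Finset.mem_singleton] at h h3
    rcases h with (h | h) | h
    · exact absurd (h.2.symm.trans h3.2) (by decide)
    · exact absurd (h.2.symm.trans h3.2) (by decide)
    · exact absurd (h.2.symm.trans h3.2) (by decide)
  rw [Finset.card_union_of_disjoint d0123, Finset.card_union_of_disjoint d012, Finset.card_union_of_disjoint d01,
    Finset.card_product, Finset.card_product, Finset.card_product, Finset.card_product]
  simp

variable [PartialOrder X]

/-- **Up-closedness of sheet-built sets.**  If the four sheets are up-sets of `X` forming a T-pattern for the down-set `L`, the sheet-built set is up-closed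
for the wedge-gluing relation (the `←` half of `AntitheticWedgePoset.upset_iff`, in sheet form). -/
theorem quad_upset (L : Finset X) (hLdown : ∀ x y : X, x ≤ y → y ∈ L → x ∈ L) (S₀ S₁ S₂ S₃ : Finset X)
    (h0 : ∀ x y, x ≤ y → x ∈ S₀ → y ∈ S₀) (h1 : ∀ x y, x ≤ y → x ∈ S₁ → y ∈ S₁)
    (h2 : ∀ x y, x ≤ y → x ∈ S₂ → y ∈ S₂) (h3 : ∀ x y, x ≤ y → x ∈ S₃ → y ∈ S₃)
    (h02 : S₀ ⊆ S₂) (h13 : S₁ ⊆ S₃) (h23 : ∀ x, x ∈ L → x ∈ S₂ → x ∈ S₃) (h01 : ∀ x, x ∉ L → x ∈ S₀ → x ∈ S₁)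
    (hC23 : ∀ x y, x ≤ y → x ∈ L → y ∉ L → x ∈ S₂ → y ∈ S₃) (hC12 : ∀ x y, x ≤ y → x ∈ L → y ∉ L → x ∈ S₁ → y ∈ S₂) :
    ∀ p q : X × Fin 4,
      (p.1 ≤ q.1 ∧ (p.2 = q.2 ∨ (p.2 = 0 ∧ q.2 = 2) ∨ (p.2 = 1 ∧ q.2 = 3) ∨ (p.2 = 0 ∧ q.2 = 3) ∨ (p.2 = 2 ∧ q.2 = 3 ∧ p.1 ∈ L) ∨
        (p.2 = 0 ∧ q.2 = 1 ∧ q.1 ∉ L) ∨ (p.2 = 1 ∧ q.2 = 2 ∧ p.1 ∈ L ∧ q.1 ∉ L))) →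
      p ∈ S₀ ×ˢ ({0} : Finset (Fin 4)) ∪ S₁ ×ˢ ({1} : Finset (Fin 4)) ∪ S₂ ×ˢ ({2} : Finset (Fin 4)) ∪ S₃ ×ˢ ({3} : Finset (Fin 4)) →
      q ∈ S₀ ×ˢ ({0} : Finset (Fin 4)) ∪ S₁ ×ˢ ({1} : Finset (Fin 4)) ∪ S₂ ×ˢ ({2} : Finset (Fin 4)) ∪ S₃ ×ˢ ({3} : Finset (Fin 4)) := by
  apply (AntitheticWedgePoset.upset_iff L hLdown _).2
  refine ⟨?_, ?_, ?_, ?_, ?_, ?_, ?_⟩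
  · intro i s t hst hs
    rw [mem_quad] at hs ⊢
    rcases hs with ⟨hi, hm⟩ | ⟨hi, hm⟩ | ⟨hi, hm⟩ | ⟨hi, hm⟩
    · exact Or.inl ⟨hi, h0 s t hst hm⟩
    · exact Or.inr (Or.inl ⟨hi, h1 s t hst hm⟩)
    · exact Or.inr (Or.inr (Or.inl ⟨hi, h2 s t hst hm⟩))
    · exact Or.inr (Or.inr (Or.inr ⟨hi, h3 s t hst hm⟩))
  · intro s hs
    rw [mem_quad] at hs ⊢; simp at hs ⊢; exact h02 hs
  · intro s hs
    rw [mem_quad] at hs ⊢; simp at hs ⊢; exact h13 hs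
  · intro s hL hs
    rw [mem_quad] at hs ⊢; simp at hs ⊢; exact h23 s hL hs
  · intro s hL hs
    rw [mem_quad] at hs ⊢; simp at hs ⊢; exact h01 s hL hs
  · intro s t hst hsL htL hs
    rw [mem_quad] at hs ⊢; simp at hs ⊢; exact hC23 s t hst hsL htL hs
  · intro s t hst hsL htL hs
    rw [mem_quad] at hs ⊢; simp at hs ⊢; exact hC12 s t hst hsL htL hs

end AntitheticWedgeQuad

end Summit.CriticalPhenomena.PercolationContinuityZ3.Theorems
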